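import Summits.SmoothPoincare4.SmoothPoincare4.Theses.InformationMetricHadamard
import Literature.Geometry.Riemannian.NormalExpTubular
import Literature.Geometry.Riemannian.NormalExpFermi
import Literature.Geometry.Riemannian.RiemannianDistance

/-!
# Stub `stub_nearLevelSection` of line `core-distance-morse` — auxiliary file 2: the calibrated
# tube of a compact hypersurface (crux `InformationMetricHadamard.C0AhRecognition`, stmt-SmoothPoincare4-6015)

Metric structure of the `ε`-tube of a compact hypersurface `ι : N⁴ → W⁵` with a smooth `G`-unit
normal field `ν` (`G(ν,ν) = 1`, `ν ⊥_G dι`): in the Fermi chart `ψ = E⁻¹` of the normal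
exponential map `E(z,t) = exp_{ι z}(t ν z)` (`NormalExpTubular.lean`) the normal coordinate
`τ = pr₂ ∘ ψ` is `1`-Lipschitz for `G` — the hypersurface Gauss lemma `E^*G = dt² + g_t`
(`NormalExpFermi.val_mfderiv_normalExp`) gives `|dτ(ξ)| ≤ |ξ|_G` — so `|Δτ| ≤ L_G(γ)` along every
`C¹` path in the tube, and closed sub-tubes `E(N × [-ε', ε'])`, `ε' < ε`, are compact, so a path
can only leave the tube through normal heights close to `ε`.

* `NearLevelSection.abs_mfderiv_normalCoord_le` — `|dτ(ξ)| ≤ |ξ|_G` on the tube;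
* `NearLevelSection.ofReal_abs_sub_normalCoord_le_length` — `|τ(γ b) − τ(γ a)| ≤ L(γ|[a,b])`;
* `NearLevelSection.closure_subset_source_of_abs_le` — closed sub-tubes are closed in `W`;
* `NearLevelSection.tube_sides` — a transversal tube curve through a two-sided hypersurface
  `range ι = ∂U` stays on the side it enters;
* `helper_nearLevelSection_2` — the registered helper: existence of the calibrated tube.

Everything is proved (kind = proof); no definitions.
-/

noncomputable section

-- the prescribed namespace `Summit.<P>.<Sub>.…` duplicates `SmoothPoincare4` (P = Sub)
set_option linter.dupNamespace false

open scoped Manifold ContDiff Topology ENNReal NNReal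
open Set Function Bundle Filter

namespace Summit.SmoothPoincare4.SmoothPoincare4.Cruxes.C0AhRecognition.CoreDistanceMorse

open Literature.Geometry.Lorentzian (PseudoRiemannianMetric)
open Literature.Geometry.Riemannian
open Literature.Topology.FourManifolds (exists_chart_of_injOn_of_isLocalDiffeomorphAt)

namespace NearLevelSection

/-! ### Transport of metric values between equal base points -/

/-- Transport of a metric square along equal base points and equal vectors (all tangent spaces
are the model vector space). [folklore] -/
theorem val_congr_point {W : Type} [TopologicalSpace W] [ChartedSpace (EuclideanSpace ℝ (Fin 5)) W]
    [IsManifold (𝓡 5) ∞ W]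
    (G : PseudoRiemannianMetric (𝓡 5) ∞ (EuclideanSpace ℝ (Fin 5)) (TangentSpace (𝓡 5) : W → Type _))
    {p p' : W} (hp : p = p') {V : TangentSpace (𝓡 5) p} {V' : TangentSpace (𝓡 5) p'}
    (hV : (V : EuclideanSpace ℝ (Fin 5)) = V') : G.val p V V = G.val p' V' V' := by
  subst hp
  subst hV
  rfl

/-! ### The calibration `|dτ| ≤ |·|_G` in a Fermi chart -/

section Calibration

variable {N : Type} [TopologicalSpace N]
  [ChartedSpace (EuclideanSpace ℝ (Fin 4)) N] [IsManifold (𝓡 4) ∞ N]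
  {W : Type} [TopologicalSpace W] [T2Space W]
  [ChartedSpace (EuclideanSpace ℝ (Fin 5)) W] [IsManifold (𝓡 5) ∞ W]
  (G : PseudoRiemannianMetric (𝓡 5) ∞ (EuclideanSpace ℝ (Fin 5)) (TangentSpace (𝓡 5) : W → Type _))
  (hG : G.IsRiemannian) [G.HasLeviCivita]
  [CovariantDerivative.ContMDiffCovariantDerivative G.leviCivita 1]
  [CovariantDerivative.ContMDiffCovariantDerivative G.leviCivita ((⊤ : ℕ∞) : ℕ∞ω)]
  {ι : N → W} {ν : Π z : N, TangentSpace (𝓡 5) (ι z)}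
  (hν : ContMDiff (𝓡 4) (𝓡 5).tangent ∞ (fun z ↦
    (TotalSpace.mk' (EuclideanSpace ℝ (Fin 5)) (ι z) (ν z) : TangentBundle (𝓡 5) W)))
  (hunit : ∀ z : N, G.val (ι z) (ν z) (ν z) = 1)
  (hperp : ∀ (z : N) (w : TangentSpace (𝓡 4) z), G.val (ι z) (mfderiv (𝓡 4) (𝓡 5) ι z w) (ν z) = 0)
  (ψ : OpenPartialHomeomorph W (N × ℝ))
  (hsymm : ∀ q : N × ℝ, ψ.symm q = expMap G.leviCivita (ι q.1) (q.2 • ν q.1))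
  (hdomψ : ∀ q ∈ ψ.target, q.2 ∈ maximalGeodesicDomain G.leviCivita (ι q.1) (ν q.1))

include hG hν hunit hperp hsymm hdomψ

/-- **The semigeodesic lower bound**: at a point `q = (z, t)` of the domain of the normal
exponential map `E` of a unit normal field, `G(dE_q u, dE_q u) ≥ (u.2)²` for every
`u = (w, a) ∈ T_q(N × ℝ)` (`E^*G = dt² + g_t` with `g_t ≥ 0`, `val_mfderiv_normalExp`).
[cite: LeeRiemannianManifolds2018, Cor. 6.42 (a)] -/
theorem sq_le_val_mfderiv_normalExp (q : N × ℝ) (hq : q ∈ ψ.target)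
    (u : TangentSpace ((𝓡 4).prod 𝓘(ℝ, ℝ)) q) :
    u.2 ^ 2 ≤ G.val (ψ.symm q)
      (mfderiv ((𝓡 4).prod 𝓘(ℝ, ℝ)) (𝓡 5)
        (fun q : N × ℝ ↦ expMap G.leviCivita (ι q.1) (q.2 • ν q.1)) q u)
      (mfderiv ((𝓡 4).prod 𝓘(ℝ, ℝ)) (𝓡 5)
        (fun q : N × ℝ ↦ expMap G.leviCivita (ι q.1) (q.2 • ν q.1)) q u) := by
  have hdom := hdomψ q hq
  rw [hsymm q]
  obtain ⟨z, t⟩ := q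
  obtain ⟨w, a⟩ := u
  have hVV : ∀ z' : N, G.val (ι z') (ν z') (ν z') = G.val (ι z) (ν z) (ν z) := fun z' ↦ by
    rw [hunit, hunit]
  have h := val_mfderiv_normalExp G hν hVV (hperp z) hdom w w a a
  have hnn : 0 ≤ G.val (expMap G.leviCivita (ι z) (t • ν z))
      (mfderiv ((𝓡 4).prod 𝓘(ℝ, ℝ)) (𝓡 5)
        (fun q : N × ℝ ↦ expMap G.leviCivita (ι q.1) (q.2 • ν q.1)) (z, t)
        ((w, (0 : ℝ)) : TangentSpace ((𝓡 4).prod 𝓘(ℝ, ℝ)) (z, t)))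
      (mfderiv ((𝓡 4).prod 𝓘(ℝ, ℝ)) (𝓡 5)
        (fun q : N × ℝ ↦ expMap G.leviCivita (ι q.1) (q.2 • ν q.1)) (z, t)
        ((w, (0 : ℝ)) : TangentSpace ((𝓡 4).prod 𝓘(ℝ, ℝ)) (z, t))) := by
    set X := mfderiv ((𝓡 4).prod 𝓘(ℝ, ℝ)) (𝓡 5)
        (fun q : N × ℝ ↦ expMap G.leviCivita (ι q.1) (q.2 • ν q.1)) (z, t)
        ((w, (0 : ℝ)) : TangentSpace ((𝓡 4).prod 𝓘(ℝ, ℝ)) (z, t))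
    by_cases hX : X = 0
    · rw [hX]; simp
    · exact (hG _ X hX).le
  change a ^ 2 ≤ _
  rw [h, hunit z, mul_one]
  nlinarith

variable (hψ : ContMDiffOn (𝓡 5) ((𝓡 4).prod 𝓘(ℝ, ℝ)) ∞ ψ ψ.source)

include hψ

/-- **The calibration inequality in a Fermi chart**: on the source of the chart `ψ = E⁻¹` the
normal coordinate `τ = pr₂ ∘ ψ` satisfies `|dτ_x(ξ)| ≤ |ξ|_G` (write `ξ = dE(w, a)`, so that
`dτ(ξ) = a` and `|ξ|²_G = a² + |dE(w,0)|²_G ≥ a²`). (Lee 2018, proof of Thm. 6.34 / Cor. 6.42: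
`|∇r| = 1`.) [cite: LeeRiemannianManifolds2018, Cor. 6.42 (a)] -/
theorem abs_mfderiv_normalCoord_le {x : W} (hx : x ∈ ψ.source) (ξ : TangentSpace (𝓡 5) x) :
    |(show ℝ from mfderiv (𝓡 5) 𝓘(ℝ, ℝ) (fun y ↦ (ψ y).2) x ξ)| ≤ Real.sqrt (G.val x ξ ξ) := by
  set NE : N × ℝ → W := fun q ↦ expMap G.leviCivita (ι q.1) (q.2 • ν q.1) with hNE
  have hq : ψ x ∈ ψ.target := ψ.map_source hx
  have hEd : MDifferentiableAt ((𝓡 4).prod 𝓘(ℝ, ℝ)) (𝓡 5) NE (ψ x) :=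
    (contMDiffAt_normalExp (cov := G.leviCivita) (k := (⊤ : ℕ∞)) le_top hν
      (hdomψ _ hq)).mdifferentiableAt (by simp)
  have hψd : MDifferentiableAt (𝓡 5) ((𝓡 4).prod 𝓘(ℝ, ℝ)) ψ x :=
    (hψ.contMDiffAt (ψ.open_source.mem_nhds hx)).mdifferentiableAt (by simp)
  -- `E ∘ ψ = id` near `x`, so `ξ = dE (dψ ξ)`
  have hcomp : HasMFDerivAt (𝓡 5) (𝓡 5) (NE ∘ ψ) x
      ((mfderiv ((𝓡 4).prod 𝓘(ℝ, ℝ)) (𝓡 5) NE (ψ x)).comp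
        (mfderiv (𝓡 5) ((𝓡 4).prod 𝓘(ℝ, ℝ)) ψ x)) :=
    hEd.hasMFDerivAt.comp x hψd.hasMFDerivAt
  have heq : (id : W → W) =ᶠ[𝓝 x] NE ∘ ψ := by
    filter_upwards [ψ.open_source.mem_nhds hx] with y hy
    simp only [comp_apply, hNE, ← hsymm, ψ.left_inv hy, id_eq]
  have hid : (mfderiv ((𝓡 4).prod 𝓘(ℝ, ℝ)) (𝓡 5) NE (ψ x)).comp
      (mfderiv (𝓡 5) ((𝓡 4).prod 𝓘(ℝ, ℝ)) ψ x) = ContinuousLinearMap.id ℝ _ := by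
    have h := (hcomp.congr_of_eventuallyEq heq).mfderiv
    rw [mfderiv_id] at h
    exact h.symm
  have hξ : mfderiv ((𝓡 4).prod 𝓘(ℝ, ℝ)) (𝓡 5) NE (ψ x)
      (mfderiv (𝓡 5) ((𝓡 4).prod 𝓘(ℝ, ℝ)) ψ x ξ) = ξ :=
    DFunLike.congr_fun hid ξ
  -- `dτ ξ = (dψ ξ).2`
  have hτ : mfderiv (𝓡 5) 𝓘(ℝ, ℝ) (fun y ↦ (ψ y).2) x ξ =
      (mfderiv (𝓡 5) ((𝓡 4).prod 𝓘(ℝ, ℝ)) ψ x ξ).2 := by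
    have h := ((hasMFDerivAt_snd (I := 𝓡 4) (I' := 𝓘(ℝ, ℝ)) (ψ x)).comp x
      hψd.hasMFDerivAt).mfderiv
    change mfderiv (𝓡 5) 𝓘(ℝ, ℝ) (Prod.snd ∘ ψ) x ξ = _
    rw [h]
    rfl
  -- the Gauss lemma at `ψ x`, transported to `x = E (ψ x)`
  have hsq := sq_le_val_mfderiv_normalExp G hG hν hunit hperp ψ hsymm hdomψ (ψ x) hq
    (mfderiv (𝓡 5) ((𝓡 4).prod 𝓘(ℝ, ℝ)) ψ x ξ)
  have hxE : ψ.symm (ψ x) = x := ψ.left_inv hx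
  rw [val_congr_point G hxE (V' := ξ) (by rw [hξ])] at hsq
  rw [hτ]
  exact Real.abs_le_sqrt hsq

/-- **Normal heights are controlled by length**: for a `C¹` path `γ` staying in the tube on
`[a, b]`, `|τ(γ b) − τ(γ a)| ≤ L_G(γ|[a,b])` (integrate the calibration inequality along the
`C¹` function `τ ∘ γ`; fundamental theorem of calculus). (Lee 2018, proof of Prop. 6.11 /
Thm. 6.34.) [cite: LeeRiemannianManifolds2018, Prop. 6.11 (proof)] -/
theorem ofReal_abs_sub_normalCoord_le_length {γ : ℝ → W} (hγ : ContMDiff 𝓘(ℝ, ℝ) (𝓡 5) 1 γ)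
    {a b : ℝ} (hab : a ≤ b) (hγT : ∀ r ∈ Icc a b, γ r ∈ ψ.source) :
    ENNReal.ofReal |(ψ (γ b)).2 - (ψ (γ a)).2| ≤ G.length hG γ a b := by
  letI := G.riemannianBundle hG
  set F : W → ℝ := fun y ↦ (ψ y).2 with hF
  have hFat : ∀ r ∈ Icc a b, ContMDiffAt (𝓡 5) 𝓘(ℝ, ℝ) ∞ F (γ r) := fun r hr ↦
    contMDiffAt_snd.comp (γ r) (hψ.contMDiffAt (ψ.open_source.mem_nhds (hγT r hr)))
  have hΛ : ContDiffOn ℝ 1 (F ∘ γ) (Icc a b) := contMDiffOn_iff_contDiffOn.1 fun r hr ↦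
    ((hFat r hr).of_le (by exact_mod_cast le_top)).comp_contMDiffWithinAt r
      (hγ r).contMDiffWithinAt
  have h2 : ∀ r ∈ Icc a b, ‖deriv (F ∘ γ) r‖ₑ ≤ ‖mfderiv 𝓘(ℝ, ℝ) (𝓡 5) γ r 1‖ₑ := fun r hr ↦ by
    have hcomp : HasMFDerivAt 𝓘(ℝ, ℝ) 𝓘(ℝ, ℝ) (F ∘ γ) r
        ((mfderiv (𝓡 5) 𝓘(ℝ, ℝ) F (γ r)).comp (mfderiv 𝓘(ℝ, ℝ) (𝓡 5) γ r)) :=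
      ((hFat r hr).mdifferentiableAt (by simp)).hasMFDerivAt.comp r
        ((hγ r).mdifferentiableAt (by simp)).hasMFDerivAt
    have e2 : fderiv ℝ (F ∘ γ) r = mfderiv 𝓘(ℝ, ℝ) 𝓘(ℝ, ℝ) (F ∘ γ) r :=
      (mfderiv_eq_fderiv (f := F ∘ γ) (x := r)).symm
    have hderiv : deriv (F ∘ γ) r =
        mfderiv (𝓡 5) 𝓘(ℝ, ℝ) F (γ r) (mfderiv 𝓘(ℝ, ℝ) (𝓡 5) γ r 1) := by
      rw [show deriv (F ∘ γ) r = fderiv ℝ (F ∘ γ) r 1 from rfl, e2, hcomp.mfderiv]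
      rfl
    have hb := abs_mfderiv_normalCoord_le G hG hν hunit hperp ψ hsymm hdomψ hψ (hγT r hr)
      (mfderiv 𝓘(ℝ, ℝ) (𝓡 5) γ r 1)
    rw [Real.enorm_eq_ofReal_abs, hderiv, ← ofReal_norm, PseudoRiemannianMetric.norm_eq_sqrt G hG]
    exact ENNReal.ofReal_le_ofReal hb
  calc ENNReal.ofReal |F (γ b) - F (γ a)|
      = ‖(F ∘ γ) b - (F ∘ γ) a‖ₑ := by rw [Real.enorm_eq_ofReal_abs]; rfl
    _ ≤ ∫⁻ r in Icc a b, ‖deriv (F ∘ γ) r‖ₑ := enorm_sub_le_lintegral_deriv_of_contDiffOn_Icc hΛ hab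
    _ ≤ ∫⁻ r in Icc a b, ‖mfderiv 𝓘(ℝ, ℝ) (𝓡 5) γ r 1‖ₑ :=
        MeasureTheory.setLIntegral_mono' measurableSet_Icc h2
    _ = G.length hG γ a b := Manifold.pathELength_eq_lintegral_mfderiv_Icc.symm

end Calibration

/-! ### Closed sub-tubes are closed; the two sides of the hypersurface -/

section Topology

variable {N : Type} [TopologicalSpace N] {W : Type} [TopologicalSpace W]

/-- **Closed sub-tubes are closed in `W`**: if the chart `ψ` has target `N × (-ε, ε)` with `N`
compact and continuous inverse, then every subset of its source on which `|τ| ≤ ε' < ε` has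
closure inside the source (it lies in the compact set `ψ⁻¹(N × [-ε', ε'])`). [folklore] -/
theorem closure_subset_source_of_abs_le [CompactSpace N] [T2Space W] (ψ : OpenPartialHomeomorph W (N × ℝ))
    {ε ε' : ℝ} (hε' : ε' < ε) (htgt : ψ.target = (univ : Set N) ×ˢ Ioo (-ε) ε)
    {S : Set W} (hS : S ⊆ ψ.source) (hSτ : ∀ x ∈ S, |(ψ x).2| ≤ ε') :
    closure S ⊆ ψ.source := by
  set C : Set W := ψ.symm '' ((univ : Set N) ×ˢ Icc (-ε') ε') with hC
  have hsub : ((univ : Set N) ×ˢ Icc (-ε') ε' : Set (N × ℝ)) ⊆ ψ.target := by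
    rw [htgt]
    exact prod_mono Subset.rfl fun t ht ↦ ⟨by linarith [ht.1], by linarith [ht.2]⟩
  have hCc : IsCompact C :=
    (isCompact_univ.prod isCompact_Icc).image_of_continuousOn (ψ.continuousOn_symm.mono hsub)
  have hCsrc : C ⊆ ψ.source := by
    rintro _ ⟨q, hq, rfl⟩
    exact ψ.map_target (hsub hq)
  have hSC : S ⊆ C := fun x hx ↦ by
    refine ⟨ψ x, ⟨mem_univ _, ?_⟩, ψ.left_inv (hS hx)⟩
    exact abs_le.1 (hSτ x hx)
  exact (closure_minimal hSC hCc.isClosed).trans hCsrc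

/-- **The two sides of a tube across a two-sided hypersurface.** Let `T : N × ℝ → W` be
continuous and injective on `N × (-ε, ε)` with `T(z, 0) = ι z`, and let `U ⊆ W` be open with
`∂U = range ι`. If the curve `t ↦ T(z, t)` lies in `U` for small `t > 0` and outside `U` for
small `t < 0`, then `T(z, t) ∈ U` for all `t ∈ (0, ε)` and `T(z, t) ∉ cl U` for all
`t ∈ (-ε, 0)`: each half-curve is connected and avoids `range ι = ∂U` (injectivity), hence stays
in one of the open sets `U`, `W ∖ cl U`. (Lee 2018, Thm. 5.25 / Example 6.44, two-sidedness of
Fermi coordinates.) [folklore] -/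
theorem tube_sides {ι : N → W} {T : N × ℝ → W} {ε : ℝ} (hT0 : ∀ z, T (z, 0) = ι z)
    (hTinj : InjOn T ((univ : Set N) ×ˢ Ioo (-ε) ε))
    (hTc : ContinuousOn T ((univ : Set N) ×ˢ Ioo (-ε) ε))
    {U : Set W} (hUo : IsOpen U) (hfr : frontier U = range ι) (z : N)
    (hplus : ∀ᶠ t in 𝓝[>] (0 : ℝ), T (z, t) ∈ U) (hminus : ∀ᶠ t in 𝓝[<] (0 : ℝ), T (z, t) ∉ U) :
    (∀ t ∈ Ioo 0 ε, T (z, t) ∈ U) ∧ (∀ t ∈ Ioo (-ε) 0, T (z, t) ∉ closure U) := by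
  set γ : ℝ → W := fun t ↦ T (z, t) with hγ
  -- the two open sides of the hypersurface
  set U₂ : Set W := (closure U)ᶜ with hU₂
  have hU₂o : IsOpen U₂ := isClosed_closure.isOpen_compl
  have hdisj : Disjoint U U₂ := by
    rw [Set.disjoint_iff]
    rintro p ⟨hp, hp'⟩
    exact hp' (subset_closure hp)
  -- off `t = 0` the tube avoids the hypersurface
  have hside : ∀ t ∈ Ioo (-ε) ε, t ≠ 0 → γ t ∈ U ∪ U₂ := by
    intro t ht ht0
    have hnot : γ t ∉ frontier U := by
      rw [hfr]
      rintro ⟨z', hz'⟩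
      have hEq : T (z, t) = T (z', 0) := by rw [hT0 z', hz']
      have hε : 0 < ε := by linarith [ht.1, ht.2]
      have h := hTinj (mk_mem_prod (mem_univ z) ht) (mk_mem_prod (mem_univ z') ⟨by linarith, hε⟩) hEq
      exact ht0 (congrArg Prod.snd h)
    by_cases hcl : γ t ∈ closure U
    · left
      have hint : γ t ∈ interior U := by
        by_contra hni
        exact hnot ⟨hcl, hni⟩
      exact interior_subset hint
    · exact Or.inr hcl
  have hγc : ∀ {a b : ℝ}, Ioo a b ⊆ Ioo (-ε) ε → ContinuousOn γ (Ioo a b) := by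
    intro a b hab
    have h1 : ContinuousOn (fun t : ℝ ↦ ((z, t) : N × ℝ)) (Ioo a b) :=
      (continuous_const.prodMk continuous_id).continuousOn
    exact hTc.comp h1 fun t ht ↦ mk_mem_prod (mem_univ z) (hab ht)
  constructor
  · -- the right half-curve lies in `U`
    intro t ht
    have hε : 0 < ε := ht.1.trans ht.2
    have hsub : γ '' Ioo 0 ε ⊆ U ∪ U₂ := by
      rintro _ ⟨t, ht, rfl⟩
      exact hside t ⟨by linarith [ht.1], ht.2⟩ ht.1.ne'
    have hpre : IsPreconnected (γ '' Ioo 0 ε) :=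
      isPreconnected_Ioo.image γ (hγc fun t ht ↦ ⟨by linarith [ht.1], ht.2⟩)
    rcases hpre.subset_or_subset hUo hU₂o hdisj hsub with h | h
    · exact h (mem_image_of_mem γ ht)
    · exfalso
      obtain ⟨t₀, ht₀, ht₀I⟩ := (hplus.and (Ioo_mem_nhdsGT hε)).exists
      exact h (mem_image_of_mem γ ht₀I) (subset_closure ht₀)
  · -- the left half-curve lies outside `cl U`
    intro t ht
    have hε : 0 < ε := by linarith [ht.1, ht.2]
    have hsub : γ '' Ioo (-ε) 0 ⊆ U ∪ U₂ := by
      rintro _ ⟨t, ht, rfl⟩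
      exact hside t ⟨ht.1, by linarith [ht.2]⟩ ht.2.ne
    have hpre : IsPreconnected (γ '' Ioo (-ε) 0) :=
      isPreconnected_Ioo.image γ (hγc fun t ht ↦ ⟨ht.1, by linarith [ht.2]⟩)
    rcases hpre.subset_or_subset hUo hU₂o hdisj hsub with h | h
    · exfalso
      obtain ⟨t₀, ht₀, ht₀I⟩ := (hminus.and (Ioo_mem_nhdsLT (neg_lt_zero.2 hε))).exists
      exact ht₀ (h (mem_image_of_mem γ ht₀I))
    · exact h (mem_image_of_mem γ ht)

end Topology

end NearLevelSection

/-- **Helper 2 for stub E2 (`nearLevelSection`): the calibrated tube of a compact hypersurface.**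
Let `(W⁵, G)` be Riemannian (Levi-Civita connection `C^∞`), `N⁴` compact and nonempty,
`ι : N → W` an injective immersion and `ν` a smooth `G`-unit normal field along `ι`. Then there are
`ε > 0` and a Fermi chart `ψ : W ⇀ N × ℝ` — source the open tube `E(N × (-ε, ε))`, target
`N × (-ε, ε)`, inverse the normal exponential map `E(z, t) = exp_{ι z}(t ν z)` (defined there),
smooth both ways, `E` injective with injective differentials on the tube — in which the normal
coordinate `τ = pr₂ ∘ ψ` is calibrated: `|τ(γ b) − τ(γ a)| ≤ L_G(γ|[a,b])` for every `C¹` path in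
the tube, and closed sub-tubes `{|τ| ≤ ε'}`, `ε' < ε`, are closed in `W`. (Lee 2018, Thm. 5.25,
Prop. 6.37, Cor. 6.42; the tree's `exists_uniform_tube_normalExp` and `val_mfderiv_normalExp`.)
[cite: LeeRiemannianManifolds2018, Thm. 5.25 and Cor. 6.42] -/
theorem helper_nearLevelSection_2
    (N : Type) [TopologicalSpace N] [CompactSpace N] [Nonempty N]
    [ChartedSpace (EuclideanSpace ℝ (Fin 4)) N] [IsManifold (𝓡 4) ∞ N]
    (W : Type) [TopologicalSpace W] [T2Space W]
    [ChartedSpace (EuclideanSpace ℝ (Fin 5)) W] [IsManifold (𝓡 5) ∞ W]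
    (G : PseudoRiemannianMetric (𝓡 5) ∞ (EuclideanSpace ℝ (Fin 5)) (TangentSpace (𝓡 5) : W → Type _))
    (hG : G.IsRiemannian) [G.HasLeviCivita]
    [CovariantDerivative.ContMDiffCovariantDerivative G.leviCivita 1]
    [CovariantDerivative.ContMDiffCovariantDerivative G.leviCivita ((⊤ : ℕ∞) : ℕ∞ω)]
    (ι : N → W) (hinj : Injective ι) (himm : ∀ z : N, Injective (mfderiv (𝓡 4) (𝓡 5) ι z))
    (ν : Π z : N, TangentSpace (𝓡 5) (ι z))
    (hν : ContMDiff (𝓡 4) (𝓡 5).tangent ∞ (fun z ↦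
      (Bundle.TotalSpace.mk' (EuclideanSpace ℝ (Fin 5)) (ι z) (ν z) : TangentBundle (𝓡 5) W)))
    (hunit : ∀ z : N, G.val (ι z) (ν z) (ν z) = 1)
    (hperp : ∀ (z : N) (w : TangentSpace (𝓡 4) z),
      G.val (ι z) (mfderiv (𝓡 4) (𝓡 5) ι z w) (ν z) = 0) :
    ∃ ε : ℝ, 0 < ε ∧
      (∀ z : N, ∀ t ∈ Ioo (-ε) ε, t ∈ Literature.Geometry.Riemannian.maximalGeodesicDomain G.leviCivita (ι z) (ν z)) ∧
      InjOn (fun q : N × ℝ ↦ Literature.Geometry.Riemannian.expMap G.leviCivita (ι q.1) (q.2 • ν q.1))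
        ((univ : Set N) ×ˢ Ioo (-ε) ε) ∧
      (∀ q ∈ (univ : Set N) ×ˢ Ioo (-ε) ε, Injective (mfderiv ((𝓡 4).prod 𝓘(ℝ, ℝ)) (𝓡 5)
        (fun q : N × ℝ ↦ Literature.Geometry.Riemannian.expMap G.leviCivita (ι q.1) (q.2 • ν q.1)) q)) ∧
      ∃ ψ : OpenPartialHomeomorph W (N × ℝ),
        ψ.source = (fun q : N × ℝ ↦ Literature.Geometry.Riemannian.expMap G.leviCivita (ι q.1) (q.2 • ν q.1)) ''
          ((univ : Set N) ×ˢ Ioo (-ε) ε) ∧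
        ψ.target = (univ : Set N) ×ˢ Ioo (-ε) ε ∧
        (∀ q : N × ℝ, ψ.symm q = Literature.Geometry.Riemannian.expMap G.leviCivita (ι q.1) (q.2 • ν q.1)) ∧
        (∀ q ∈ (univ : Set N) ×ˢ Ioo (-ε) ε, ψ (Literature.Geometry.Riemannian.expMap G.leviCivita (ι q.1) (q.2 • ν q.1)) = q) ∧
        ContMDiffOn (𝓡 5) ((𝓡 4).prod 𝓘(ℝ, ℝ)) ∞ ψ ψ.source ∧
        ContMDiffOn ((𝓡 4).prod 𝓘(ℝ, ℝ)) (𝓡 5) ∞ ψ.symm ψ.target ∧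
        (∀ (γ : ℝ → W), ContMDiff 𝓘(ℝ, ℝ) (𝓡 5) 1 γ → ∀ a b : ℝ, a ≤ b →
          (∀ r ∈ Icc a b, γ r ∈ ψ.source) →
          ENNReal.ofReal |(ψ (γ b)).2 - (ψ (γ a)).2| ≤ G.length hG γ a b) ∧
        (∀ ε' : ℝ, ε' < ε → ∀ S : Set W, S ⊆ ψ.source → (∀ x ∈ S, |(ψ x).2| ≤ ε') →
          closure S ⊆ ψ.source) := by
  -- transversality of the unit normal and the dimension count
  have htrans : ∀ z : N, ν z ∉ range (mfderiv (𝓡 4) (𝓡 5) ι z) := by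
    rintro z ⟨w, hw⟩
    have h0 := hperp z w
    rw [hw, hunit z] at h0
    exact one_ne_zero h0
  have hdim : Module.finrank ℝ (EuclideanSpace ℝ (Fin 4)) + 1 =
      Module.finrank ℝ (EuclideanSpace ℝ (Fin 5)) := by simp
  -- the uniform tube and its chart
  obtain ⟨ε, hε, hdom, hloc, hinjOn⟩ :=
    exists_uniform_tube_normalExp (cov := G.leviCivita) (k := (⊤ : ℕ∞)) le_top hν hinj himm
      htrans hdim
  have hWo : IsOpen ((univ : Set N) ×ˢ Ioo (-ε) ε) := isOpen_univ.prod isOpen_Ioo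
  obtain ⟨ψ, hsrc, htgt, hsymm, hleft, hψ, hψsymm⟩ :=
    exists_chart_of_injOn_of_isLocalDiffeomorphAt (I := (𝓡 4).prod 𝓘(ℝ, ℝ)) (J := 𝓡 5)
      (n := ((⊤ : ℕ∞) : ℕ∞ω)) hWo (fun q hq ↦ hloc q.1 q.2 hq.2) hinjOn
  have hdomψ : ∀ q ∈ ψ.target, q.2 ∈ maximalGeodesicDomain G.leviCivita (ι q.1) (ν q.1) := by
    intro q hq
    rw [htgt] at hq
    exact hdom q.1 q.2 hq.2
  refine ⟨ε, hε, hdom, hinjOn, ?_, ψ, hsrc, htgt, hsymm, hleft, hψ, hψsymm,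
    fun γ hγ a b hab hγT ↦ ?_, fun ε' hε' S hS hSτ ↦ ?_⟩
  · -- injective differentials: `dE_q` is a linear isomorphism at a local diffeomorphism
    rintro ⟨z, t⟩ hq
    have hn : (((⊤ : ℕ∞) : ℕ∞ω)) ≠ 0 := by simp
    rw [← (hloc z t hq.2).mfderivToContinuousLinearEquiv_coe hn]
    exact ((hloc z t hq.2).mfderivToContinuousLinearEquiv hn).injective
  · exact NearLevelSection.ofReal_abs_sub_normalCoord_le_length G hG hν hunit hperp ψ hsymm hdomψ
      hψ hγ hab hγT
  · exact NearLevelSection.closure_subset_source_of_abs_le ψ hε' htgt hS hSτ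

end Summit.SmoothPoincare4.SmoothPoincare4.Cruxes.C0AhRecognition.CoreDistanceMorse

end
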